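import Summits.AtomisticToContinuum.BoseEinsteinCondensation.Theses.BECDyadicChaining
import HarnessLib

/-!
# Crux `DyadicCoherenceDefect` (stmt-AtomisticToContinuum-13192), line `registered`:
# the registered stub `stub_windowBudget` (S4, the WINDOW BUDGET)

Supports (does not close) stmt-AtomisticToContinuum-13192.  The stub is pure bookkeeping: from
the level-occupation ladder `T_{m-1} ≤ T_m ≤ N`, `A_m ≤ A_{m-1} + √(T_m − T_{m-1})` (stub S2, the
first hypothesis) and local condensation on the Fournais–Junge window scales
`BECDyadicChaining.WindowLocalCondensation` (stub S3, the second hypothesis) it derives the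
window half of the crux: a summable budget `β ≥ 0`, `Σ_j β_j ≤ 1/8`, with
`A_m ≤ A_{m-1} + β_j √N` for every level `m ≥ 1` in bracket `j` (`2^j ≤ L/2^m < 2^{j+1}`,
bracket base `ℓ_d = 1`) whose cube side is inside the `η`-window
`L/2^m ≤ s_η := (ρa)^{-1/2} (ρa³)^{-η}`.

Proof (`a = scatteringLength`, real part; `t = ρa³`).  If `a = 0` then `s_η = 0` and the window
is empty.  If `a > 0`, apply S3 at a second exponent `η' ∈ (η, 1/4)`: it gives `γ' > 2η'`,
`C' ≥ 0` and, for near-minimisers, `T_k ≥ (1 − C' t^{γ'} max(1, ρa (L/2^k)²)) N` whenever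
`L/2^k ≤ s_{η'}`.  For a window level `m` the parent level `m − 1` has side
`2 L/2^m ≤ 2 s_η ≤ s_{η'}` once `t^{η'−η} ≤ 1/2`, and `ρa (L/2^{m-1})² ≤ 4 ρa s_η² = 4 t^{-2η}`,
so `A_m − A_{m-1} ≤ √(T_m − T_{m-1}) ≤ √(N − T_{m-1}) ≤ 2 √C' t^{γ'/2 − η} √N`.  With `ε > 0`,
`e > 0`, `e + ε(1/2 + η) = γ'/2 − η` and `2^j ≤ s_η = a t^{-(1/2+η)}` this is `≤ β_j √N`,
`β_j := 2 √C' a^ε t^e (2^{-ε})^j`, a geometric budget with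
`Σ_j β_j = 2 √C' a^ε t^e / (1 − 2^{-ε}) ≤ 1/8` for `t` small.

## References

* S. Fournais, *Length scales for BEC in the dilute Bose gas*, in: Partial Differential
  Equations, Spectral Theory, and Mathematical Physics, EMS (2021), arXiv:2011.00309, Thm. 1.2.
  [cite: Fournais2020, Thm. 1.2]
* [LSSY2005] Lieb, Seiringer, Solovej, Yngvason, *The Mathematics of the Bose Gas and its
  Condensation* (2005), §1.2 (1.17).
-/

noncomputable section

open Filter
open scoped ENNReal NNReal BigOperators

namespace Summit.AtomisticToContinuum.BoseEinsteinCondensation.Cruxes.DyadicCoherenceDefect.Birth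

open Literature.MathematicalPhysics.QuantumManyBody.BoseGas
open Summit.AtomisticToContinuum.BoseEinsteinCondensation.Theses

namespace StubWindowBudget

/-! ### Real-analysis bookkeeping -/

/-- Smallness of a positive power near `0⁺`: `c t^e ≤ b` for `0 < t < t₀`, `e > 0`, `b > 0`
(explicit `t₀ = (b/c)^{1/e}` for `c > 0`). [folklore] -/
theorem exists_rpow_small (c e b : ℝ) (he : 0 < e) (hb : 0 < b) :
    ∃ t₀ : ℝ, 0 < t₀ ∧ ∀ t : ℝ, 0 < t → t < t₀ → c * t ^ e ≤ b := by
  rcases le_or_gt c 0 with hc | hc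
  · refine ⟨1, one_pos, fun t ht _ => ?_⟩
    have : 0 ≤ t ^ e := Real.rpow_nonneg ht.le e
    nlinarith
  · refine ⟨(b / c) ^ (1 / e), Real.rpow_pos_of_pos (div_pos hb hc) _, fun t ht htlt => ?_⟩
    have h1 : t ^ e < b / c := by
      calc t ^ e < ((b / c) ^ (1 / e)) ^ e := Real.rpow_lt_rpow ht.le htlt he
        _ = b / c := by
          rw [← Real.rpow_mul (div_pos hb hc).le, one_div_mul_cancel he.ne', Real.rpow_one]
    have h2 := (lt_div_iff₀ hc).1 h1
    linarith

/-- The window top in terms of `t = ρa³`: `(ρa)^{-1/2} (ρa³)^{-η} = a t^{-(1/2+η)}` for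
`ρ, a > 0`. [folklore] -/
theorem window_top_eq {ρ a : ℝ} (η : ℝ) (hρ : 0 < ρ) (ha : 0 < a) :
    (ρ * a) ^ (-(1 : ℝ) / 2) * (ρ * a ^ 3) ^ (-η) = a * (ρ * a ^ 3) ^ (-(1 / 2 + η)) := by
  have hu : 0 < ρ * a := mul_pos hρ ha
  have ht : 0 < ρ * a ^ 3 := by positivity
  have h1 : (ρ * a ^ 3) ^ (-(1 : ℝ) / 2) = (ρ * a) ^ (-(1 : ℝ) / 2) * a⁻¹ := by
    rw [show ρ * a ^ 3 = (ρ * a) * a ^ 2 by ring, Real.mul_rpow hu.le (by positivity)]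
    congr 1
    rw [← Real.rpow_natCast a 2, ← Real.rpow_mul ha.le, ← Real.rpow_neg_one a]
    norm_num
  rw [show -(1 / 2 + η) = (-(1 : ℝ) / 2) + (-η) by ring, Real.rpow_add ht, h1]
  field_simp

/-- Window nesting: if `t^{η'-η} ≤ 1/2` (`t = ρa³`) and the level-`m` side is in the `η`-window,
`L/2^m ≤ (ρa)^{-1/2} t^{-η}`, then the parent side `L/2^{m-1} = 2 L/2^m` is in the `η'`-window.
[folklore] -/
theorem window_nesting {ρ a η η' L : ℝ} {m : ℕ} (hρ : 0 < ρ) (ha : 0 < a) (hm : 1 ≤ m)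
    (hsmall : (ρ * a ^ 3) ^ (η' - η) ≤ 1 / 2)
    (hwin : L / 2 ^ m ≤ (ρ * a) ^ (-(1 : ℝ) / 2) * (ρ * a ^ 3) ^ (-η)) :
    L / 2 ^ (m - 1) ≤ (ρ * a) ^ (-(1 : ℝ) / 2) * (ρ * a ^ 3) ^ (-η') := by
  obtain ⟨k, rfl⟩ : ∃ k, m = k + 1 := ⟨m - 1, by omega⟩
  rw [Nat.add_sub_cancel]
  have ht : 0 < ρ * a ^ 3 := by positivity
  have hpow : 0 < (ρ * a ^ 3) ^ (η' - η) := Real.rpow_pos_of_pos ht _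
  have hk : L / 2 ^ k = 2 * (L / 2 ^ (k + 1)) := by
    rw [pow_succ]
    field_simp
  have h2 : (2 : ℝ) ≤ ((ρ * a ^ 3) ^ (η' - η))⁻¹ :=
    (le_inv_comm₀ two_pos hpow).mpr (by rw [← one_div]; exact hsmall)
  have hexp : (2 : ℝ) * (ρ * a ^ 3) ^ (-η) ≤ (ρ * a ^ 3) ^ (-η') := by
    calc (2 : ℝ) * (ρ * a ^ 3) ^ (-η) ≤ ((ρ * a ^ 3) ^ (η' - η))⁻¹ * (ρ * a ^ 3) ^ (-η) :=
          mul_le_mul_of_nonneg_right h2 (Real.rpow_nonneg ht.le _)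
      _ = (ρ * a ^ 3) ^ (-η') := by
          rw [← Real.rpow_neg ht.le, ← Real.rpow_add ht]
          congr 1
          ring
  calc L / 2 ^ k = 2 * (L / 2 ^ (k + 1)) := hk
    _ ≤ 2 * ((ρ * a) ^ (-(1 : ℝ) / 2) * (ρ * a ^ 3) ^ (-η)) :=
        mul_le_mul_of_nonneg_left hwin zero_le_two
    _ = (ρ * a) ^ (-(1 : ℝ) / 2) * (2 * (ρ * a ^ 3) ^ (-η)) := by ring
    _ ≤ (ρ * a) ^ (-(1 : ℝ) / 2) * (ρ * a ^ 3) ^ (-η') :=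
        mul_le_mul_of_nonneg_left hexp (Real.rpow_nonneg (mul_pos hρ ha).le _)

/-- Inside the `η`-window the parent cube carries `ρa (L/2^{m-1})² ≤ 4 ρa s_η² = 4 t^{-2η}`.
[folklore] -/
theorem side_sq_le {ρ a η L : ℝ} {m : ℕ} (hρ : 0 < ρ) (ha : 0 < a) (hm : 1 ≤ m)
    (hL : 0 ≤ L / 2 ^ m)
    (hwin : L / 2 ^ m ≤ (ρ * a) ^ (-(1 : ℝ) / 2) * (ρ * a ^ 3) ^ (-η)) :
    ρ * a * (L / 2 ^ (m - 1)) ^ 2 ≤ 4 * (ρ * a ^ 3) ^ (-(2 * η)) := by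
  obtain ⟨k, rfl⟩ : ∃ k, m = k + 1 := ⟨m - 1, by omega⟩
  rw [Nat.add_sub_cancel]
  have hu : 0 < ρ * a := mul_pos hρ ha
  have ht : 0 < ρ * a ^ 3 := by positivity
  have hk : L / 2 ^ k = 2 * (L / 2 ^ (k + 1)) := by
    rw [pow_succ]
    field_simp
  have hsq : (L / 2 ^ (k + 1)) ^ 2 ≤ ((ρ * a) ^ (-(1 : ℝ) / 2) * (ρ * a ^ 3) ^ (-η)) ^ 2 :=
    pow_le_pow_left₀ hL hwin 2
  have e1 : ((ρ * a) ^ (-(1 : ℝ) / 2)) ^ 2 = (ρ * a)⁻¹ := by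
    rw [sq, ← Real.rpow_add hu, ← Real.rpow_neg_one (ρ * a)]
    norm_num
  have e2 : ((ρ * a ^ 3) ^ (-η)) ^ 2 = (ρ * a ^ 3) ^ (-(2 * η)) := by
    rw [sq, ← Real.rpow_add ht]
    congr 1
    ring
  have hid : ρ * a * ((ρ * a) ^ (-(1 : ℝ) / 2) * (ρ * a ^ 3) ^ (-η)) ^ 2 =
      (ρ * a ^ 3) ^ (-(2 * η)) := by
    rw [mul_pow, e1, e2, ← mul_assoc, mul_inv_cancel₀ hu.ne', one_mul]
  calc ρ * a * (L / 2 ^ k) ^ 2 = 4 * (ρ * a * (L / 2 ^ (k + 1)) ^ 2) := by rw [hk]; ring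
    _ ≤ 4 * (ρ * a * ((ρ * a) ^ (-(1 : ℝ) / 2) * (ρ * a ^ 3) ^ (-η)) ^ 2) :=
        mul_le_mul_of_nonneg_left (mul_le_mul_of_nonneg_left hsq hu.le) (by norm_num)
    _ = 4 * (ρ * a ^ 3) ^ (-(2 * η)) := by rw [hid]

/-- Exponent bookkeeping for the geometric budget: if `2^j ≤ a t^{-(1/2+η)}` then
`t^{e + ε(1/2+η)} ≤ a^ε t^e (2^{-ε})^j` (`t, a > 0`, `ε ≥ 0`). [folklore] -/
theorem exponent_bookkeeping {t a η ε e : ℝ} {j : ℕ} (ht : 0 < t) (ha : 0 < a) (hε : 0 ≤ ε)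
    (hj : (2 : ℝ) ^ j ≤ a * t ^ (-(1 / 2 + η))) :
    t ^ (e + ε * (1 / 2 + η)) ≤ a ^ ε * t ^ e * ((2 : ℝ) ^ (-ε)) ^ j := by
  have h2j : 0 < (2 : ℝ) ^ j := pow_pos two_pos j
  have h1 : ((2 : ℝ) ^ j) ^ ε ≤ a ^ ε * t ^ (-(1 / 2 + η) * ε) := by
    calc ((2 : ℝ) ^ j) ^ ε ≤ (a * t ^ (-(1 / 2 + η))) ^ ε := Real.rpow_le_rpow h2j.le hj hε
      _ = a ^ ε * t ^ (-(1 / 2 + η) * ε) := by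
          rw [Real.mul_rpow ha.le (Real.rpow_nonneg ht.le _), ← Real.rpow_mul ht.le]
  have h2 : ((2 : ℝ) ^ (-ε)) ^ j * ((2 : ℝ) ^ j) ^ ε = 1 := by
    rw [← Real.rpow_mul_natCast zero_le_two, ← Real.rpow_natCast_mul zero_le_two,
      ← Real.rpow_add two_pos, show -ε * (j : ℝ) + (j : ℝ) * ε = 0 by ring, Real.rpow_zero]
  have h4 : t ^ (ε * (1 / 2 + η)) * ((2 : ℝ) ^ j) ^ ε ≤ a ^ ε := by
    calc t ^ (ε * (1 / 2 + η)) * ((2 : ℝ) ^ j) ^ ε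
        ≤ t ^ (ε * (1 / 2 + η)) * (a ^ ε * t ^ (-(1 / 2 + η) * ε)) :=
          mul_le_mul_of_nonneg_left h1 (Real.rpow_nonneg ht.le _)
      _ = a ^ ε * (t ^ (ε * (1 / 2 + η)) * t ^ (-(1 / 2 + η) * ε)) := by ring
      _ = a ^ ε := by
          rw [← Real.rpow_add ht, show ε * (1 / 2 + η) + -(1 / 2 + η) * ε = 0 by ring,
            Real.rpow_zero, mul_one]
  have h5 : t ^ (ε * (1 / 2 + η)) ≤ a ^ ε * ((2 : ℝ) ^ (-ε)) ^ j := by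
    refine le_of_mul_le_mul_right ?_ (Real.rpow_pos_of_pos h2j ε)
    calc t ^ (ε * (1 / 2 + η)) * ((2 : ℝ) ^ j) ^ ε ≤ a ^ ε := h4
      _ = a ^ ε * (((2 : ℝ) ^ (-ε)) ^ j * ((2 : ℝ) ^ j) ^ ε) := by rw [h2, mul_one]
      _ = a ^ ε * ((2 : ℝ) ^ (-ε)) ^ j * ((2 : ℝ) ^ j) ^ ε := by ring
  rw [Real.rpow_add ht]
  calc t ^ e * t ^ (ε * (1 / 2 + η)) ≤ t ^ e * (a ^ ε * ((2 : ℝ) ^ (-ε)) ^ j) :=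
        mul_le_mul_of_nonneg_left h5 (Real.rpow_nonneg ht.le _)
    _ = a ^ ε * t ^ e * ((2 : ℝ) ^ (-ε)) ^ j := by ring

/-- The per-level budget inequality: inside the `η`-window (`1·2^j ≤ L/2^m ≤ s_η`, `t = ρa³ ≤ 1`)
the square root of the parent's occupation deficit coefficient
`C' t^{γ'} max(1, ρa (L/2^{m-1})²)` is at most `β_j = 2 √C' a^ε t^e (2^{-ε})^j` whenever
`e + ε(1/2+η) = γ'/2 − η`. [cite: Fournais2020, Thm. 1.2] -/
theorem sqrt_deficit_le {ρ a η γ' ε e C' L : ℝ} {m j : ℕ} (hρ : 0 < ρ) (ha : 0 < a)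
    (hη : 0 < η) (hC' : 0 ≤ C') (hε : 0 ≤ ε) (hm : 1 ≤ m)
    (he : e + ε * (1 / 2 + η) = γ' / 2 - η) (ht1 : ρ * a ^ 3 ≤ 1)
    (hj : 1 * (2 : ℝ) ^ j ≤ L / 2 ^ m)
    (hwin : L / 2 ^ m ≤ (ρ * a) ^ (-(1 : ℝ) / 2) * (ρ * a ^ 3) ^ (-η)) :
    Real.sqrt (C' * (ρ * a ^ 3) ^ γ' * max 1 (ρ * a * (L / 2 ^ (m - 1)) ^ 2)) ≤
      2 * Real.sqrt C' * a ^ ε * (ρ * a ^ 3) ^ e * ((2 : ℝ) ^ (-ε)) ^ j := by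
  rw [one_mul] at hj
  have ht : 0 < ρ * a ^ 3 := by positivity
  have hL : 0 ≤ L / 2 ^ m := (pow_pos two_pos j).le.trans hj
  have hmax : max 1 (ρ * a * (L / 2 ^ (m - 1)) ^ 2) ≤ 4 * (ρ * a ^ 3) ^ (-(2 * η)) := by
    refine max_le ?_ (side_sq_le hρ ha hm hL hwin)
    have : 1 ≤ (ρ * a ^ 3) ^ (-(2 * η)) :=
      Real.one_le_rpow_of_pos_of_le_one_of_nonpos ht ht1 (by linarith)
    linarith
  have hexp : γ' + -(2 * η) = (γ' / 2 - η) + (γ' / 2 - η) := by ring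
  have hX : C' * (ρ * a ^ 3) ^ γ' * max 1 (ρ * a * (L / 2 ^ (m - 1)) ^ 2) ≤
      (2 * Real.sqrt C' * (ρ * a ^ 3) ^ (γ' / 2 - η)) ^ 2 := by
    calc C' * (ρ * a ^ 3) ^ γ' * max 1 (ρ * a * (L / 2 ^ (m - 1)) ^ 2)
        ≤ C' * (ρ * a ^ 3) ^ γ' * (4 * (ρ * a ^ 3) ^ (-(2 * η))) :=
          mul_le_mul_of_nonneg_left hmax (by positivity)
      _ = 4 * C' * ((ρ * a ^ 3) ^ γ' * (ρ * a ^ 3) ^ (-(2 * η))) := by ring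
      _ = 4 * C' * ((ρ * a ^ 3) ^ (γ' / 2 - η) * (ρ * a ^ 3) ^ (γ' / 2 - η)) := by
          rw [← Real.rpow_add ht, ← Real.rpow_add ht, hexp]
      _ = (2 * Real.sqrt C' * (ρ * a ^ 3) ^ (γ' / 2 - η)) ^ 2 := by
          rw [mul_pow, mul_pow, Real.sq_sqrt hC', sq ((ρ * a ^ 3) ^ (γ' / 2 - η))]
          norm_num
  have h1 : Real.sqrt (C' * (ρ * a ^ 3) ^ γ' * max 1 (ρ * a * (L / 2 ^ (m - 1)) ^ 2)) ≤
      2 * Real.sqrt C' * (ρ * a ^ 3) ^ (γ' / 2 - η) := by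
    calc Real.sqrt (C' * (ρ * a ^ 3) ^ γ' * max 1 (ρ * a * (L / 2 ^ (m - 1)) ^ 2))
        ≤ Real.sqrt ((2 * Real.sqrt C' * (ρ * a ^ 3) ^ (γ' / 2 - η)) ^ 2) :=
          Real.sqrt_le_sqrt hX
      _ = 2 * Real.sqrt C' * (ρ * a ^ 3) ^ (γ' / 2 - η) := Real.sqrt_sq (by positivity)
  have hj' : (2 : ℝ) ^ j ≤ a * (ρ * a ^ 3) ^ (-(1 / 2 + η)) := by
    rw [← window_top_eq η hρ ha]
    exact hj.trans hwin
  have h2 := exponent_bookkeeping (e := e) ht ha hε hj'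
  rw [he] at h2
  calc Real.sqrt (C' * (ρ * a ^ 3) ^ γ' * max 1 (ρ * a * (L / 2 ^ (m - 1)) ^ 2))
      ≤ 2 * Real.sqrt C' * (ρ * a ^ 3) ^ (γ' / 2 - η) := h1
    _ ≤ 2 * Real.sqrt C' * (a ^ ε * (ρ * a ^ 3) ^ e * ((2 : ℝ) ^ (-ε)) ^ j) :=
        mul_le_mul_of_nonneg_left h2 (by positivity)
    _ = 2 * Real.sqrt C' * a ^ ε * (ρ * a ^ 3) ^ e * ((2 : ℝ) ^ (-ε)) ^ j := by ring

/-! ### The `ℝ≥0∞` step -/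

/-- The defect step in `ℝ≥0∞`: from `T_k ≥ (1 − X) N`, `T_{k+1} ≤ N`,
`A_{k+1} ≤ A_k + √(T_{k+1} − T_k)` and `√X ≤ b` conclude `A_{k+1} ≤ A_k + b √N`.
[cite: LSSY2005, §1.2 (1.17)] -/
theorem defect_le {Tk Tk1 Ak Ak1 : ℝ≥0∞} {N : ℕ} {X b : ℝ} (hX : 0 ≤ X)
    (hocc : ENNReal.ofReal ((1 - X) * N) ≤ Tk) (hTN : Tk1 ≤ N)
    (hA : Ak1 ≤ Ak + (Tk1 - Tk) ^ (1 / 2 : ℝ)) (hb : Real.sqrt X ≤ b) :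
    Ak1 ≤ Ak + ENNReal.ofReal b * (N : ℝ≥0∞) ^ (1 / 2 : ℝ) := by
  have hN : (0 : ℝ) ≤ N := Nat.cast_nonneg N
  have h1 : Tk1 - Tk ≤ ENNReal.ofReal (X * N) := by
    calc Tk1 - Tk ≤ (N : ℝ≥0∞) - Tk := tsub_le_tsub_right hTN Tk
      _ ≤ (N : ℝ≥0∞) - ENNReal.ofReal ((1 - X) * N) := tsub_le_tsub_left hocc _
      _ ≤ ENNReal.ofReal (X * N) := by
          refine tsub_le_iff_left.mpr ?_
          calc (N : ℝ≥0∞) = ENNReal.ofReal ((1 - X) * N + X * N) := by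
                rw [← ENNReal.ofReal_natCast]
                congr 1
                ring
            _ ≤ ENNReal.ofReal ((1 - X) * N) + ENNReal.ofReal (X * N) := ENNReal.ofReal_add_le
  have h2 : (Tk1 - Tk) ^ (1 / 2 : ℝ) ≤ ENNReal.ofReal b * (N : ℝ≥0∞) ^ (1 / 2 : ℝ) := by
    calc (Tk1 - Tk) ^ (1 / 2 : ℝ) ≤ (ENNReal.ofReal (X * N)) ^ (1 / 2 : ℝ) :=
          ENNReal.rpow_le_rpow h1 (by norm_num)
      _ = ENNReal.ofReal (Real.sqrt X) * (N : ℝ≥0∞) ^ (1 / 2 : ℝ) := by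
          rw [ENNReal.ofReal_mul hX, ENNReal.mul_rpow_of_nonneg _ _ (by norm_num : (0 : ℝ) ≤ 1 / 2),
            ENNReal.ofReal_natCast, ENNReal.ofReal_rpow_of_nonneg hX (by norm_num),
            Real.sqrt_eq_rpow]
      _ ≤ ENNReal.ofReal b * (N : ℝ≥0∞) ^ (1 / 2 : ℝ) :=
          mul_le_mul' (ENNReal.ofReal_le_ofReal hb) le_rfl
  exact hA.trans (add_le_add le_rfl h2)

end StubWindowBudget

open StubWindowBudget in
/-- **Stub S4 (M/L): the window budget** — the level ladder (S2) and local condensation on all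
window scales (S3 = `BECDyadicChaining.WindowLocalCondensation`) give the window part of the crux
with budget `Σ ≤ 1/8`: per window level
`defect_m ≤ √(T_m − T_{m-1}) ≤ √(N − T_{m-1}) ≤ 2 √(C'(ρa³)^{γ'−2η}) √N` (S3 at a second exponent
`η' ∈ (η, 1/4)`), dominated by the geometric budget `β_j = 2√C' a^ε (ρa³)^e 2^{-εj}` on the window
brackets `2^j ≤ s_η = a (ρa³)^{-(1/2+η)}`, whose sum `→ 0` as `ρ → 0` since `γ' > 2η`.
[cite: Fournais2020, Thm. 1.2] -/
theorem stub_windowBudget :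
    (∀ (N : ℕ) (L : ℝ) (Ψ : TrialState N L) (m : ℕ), 1 ≤ m →
      let φ : (m : ℕ) → (Fin 3 → Fin (2 ^ m)) → EuclideanSpace ℝ (Fin 3) → ℂ := fun m i =>
        Set.indicator {x : EuclideanSpace ℝ (Fin 3) | ∀ k : Fin 3, x k ∈
            Set.Ioo (((i k : ℕ) : ℝ) * (L / 2 ^ m)) ((((i k : ℕ) : ℝ) + 1) * (L / 2 ^ m))}
          (fun _ => ((Real.sqrt ((L / 2 ^ m) ^ 3))⁻¹ : ℂ))
      let T : ℕ → ℝ≥0∞ := fun m => ∑ i : Fin 3 → Fin (2 ^ m), occupation N (φ m i) Ψ.ψ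
      let A : ℕ → ℝ≥0∞ := fun m => (8 : ℝ≥0∞) ^ (-(m : ℝ) / 2) *
        ∑ i : Fin 3 → Fin (2 ^ m), (occupation N (φ m i) Ψ.ψ) ^ (1 / 2 : ℝ)
      T (m - 1) ≤ T m ∧ T m ≤ N ∧ A m ≤ A (m - 1) + (T m - T (m - 1)) ^ (1 / 2 : ℝ)) →
    BECDyadicChaining.WindowLocalCondensation →
    ∀ v : ℝ → ℝ≥0∞, IsRepulsiveFiniteRange v → ∀ η : ℝ, 0 < η → η < 1 / 4 → ∃ ℓd : ℝ, 0 < ℓd ∧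
      ∃ ρ₀ : ℝ, 0 < ρ₀ ∧ ∀ ρ : ℝ, 0 < ρ → ρ < ρ₀ →
        ∃ β : ℕ → ℝ, (∀ j, 0 ≤ β j) ∧ Summable β ∧ ∑' j, β j ≤ 1 / 8 ∧ ∀ᶠ N : ℕ in atTop,
          let a : ℝ := (scatteringLength v).toReal
          let L : ℝ := sideLength ρ N
          let φ : (m : ℕ) → (Fin 3 → Fin (2 ^ m)) → EuclideanSpace ℝ (Fin 3) → ℂ := fun m i =>
            Set.indicator {x : EuclideanSpace ℝ (Fin 3) | ∀ k : Fin 3, x k ∈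
                Set.Ioo (((i k : ℕ) : ℝ) * (L / 2 ^ m)) ((((i k : ℕ) : ℝ) + 1) * (L / 2 ^ m))}
              (fun _ => ((Real.sqrt ((L / 2 ^ m) ^ 3))⁻¹ : ℂ))
          ∃ δ : ℝ≥0∞, 0 < δ ∧ ∀ Ψ : TrialState N L, energy v Ψ ≤ groundStateEnergy v N L + δ →
            let A : ℕ → ℝ≥0∞ := fun m => (8 : ℝ≥0∞) ^ (-(m : ℝ) / 2) *
              ∑ i : Fin 3 → Fin (2 ^ m), (occupation N (φ m i) Ψ.ψ) ^ (1 / 2 : ℝ)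
            ∀ m j : ℕ, 1 ≤ m → ℓd * 2 ^ j ≤ L / 2 ^ m → L / 2 ^ m < ℓd * 2 ^ (j + 1) →
              L / 2 ^ m ≤ (ρ * a) ^ (-(1 : ℝ) / 2) * (ρ * a ^ 3) ^ (-η) →
              A m ≤ A (m - 1) + ENNReal.ofReal (β j) * (N : ℝ≥0∞) ^ (1 / 2 : ℝ) := by
  intro hI hWLC v hv η hη0 hη4
  obtain ha0 | ha := eq_or_lt_of_le (@ENNReal.toReal_nonneg (scatteringLength v))
  · -- `a = 0`: the window top is `0`, the window is empty.
    refine ⟨1, one_pos, 1, one_pos, fun ρ _ _ => ⟨fun _ => 0, fun _ => le_rfl, summable_zero,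
      by rw [tsum_zero]; norm_num, Eventually.of_forall fun N => ?_⟩⟩
    dsimp only
    refine ⟨1, one_pos, fun Ψ _ m j _ h1 _ hwin => ?_⟩
    exfalso
    have h0 : (ρ * (scatteringLength v).toReal) ^ (-(1 : ℝ) / 2) = 0 := by
      rw [← ha0, mul_zero, Real.zero_rpow (by norm_num)]
    rw [h0, zero_mul] at hwin
    have h2 := pow_pos (two_pos : (0 : ℝ) < 2) j
    linarith
  · -- `a > 0`.
    obtain ⟨η', hηη', hη'4⟩ : ∃ η' : ℝ, η < η' ∧ η' < 1 / 4 :=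
      ⟨(η + 1 / 4) / 2, by linarith, by linarith⟩
    obtain ⟨γ', C', hγ', hC', ρ₁, hρ₁, HW⟩ := hWLC v hv η' (by linarith) hη'4
    generalize (scatteringLength v).toReal = a at HW ha ⊢
    obtain ⟨ε, hε, e, he, hrel⟩ :
        ∃ ε : ℝ, 0 < ε ∧ ∃ e : ℝ, 0 < e ∧ e + ε * (1 / 2 + η) = γ' / 2 - η :=
      ⟨(γ' / 2 - η) / 2, by linarith, γ' / 2 - η - (γ' / 2 - η) / 2 * (1 / 2 + η),
        by nlinarith, by ring⟩
    have hr0 : 0 < (2 : ℝ) ^ (-ε) := Real.rpow_pos_of_pos two_pos _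
    have hr1 : (2 : ℝ) ^ (-ε) < 1 := Real.rpow_lt_one_of_one_lt_of_neg one_lt_two (by linarith)
    obtain ⟨t₂, ht₂, H₂⟩ := exists_rpow_small 1 (η' - η) (1 / 2) (by linarith) (by norm_num)
    obtain ⟨t₃, ht₃, H₃⟩ := exists_rpow_small (2 * Real.sqrt C' * a ^ ε) e
      ((1 - (2 : ℝ) ^ (-ε)) / 8) he (by linarith)
    have ha3 : 0 < a ^ 3 := by positivity
    refine ⟨1, one_pos, min (min ρ₁ (1 / a ^ 3)) (min (t₂ / a ^ 3) (t₃ / a ^ 3)), by positivity,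
      fun ρ hρ hρ0 => ?_⟩
    have hρ1 : ρ < ρ₁ := hρ0.trans_le ((min_le_left _ _).trans (min_le_left _ _))
    have hρa : ρ < 1 / a ^ 3 := hρ0.trans_le ((min_le_left _ _).trans (min_le_right _ _))
    have hρ2 : ρ < t₂ / a ^ 3 := hρ0.trans_le ((min_le_right _ _).trans (min_le_left _ _))
    have hρ3 : ρ < t₃ / a ^ 3 := hρ0.trans_le ((min_le_right _ _).trans (min_le_right _ _))
    have ht0 : 0 < ρ * a ^ 3 := by positivity
    have ht1 : ρ * a ^ 3 ≤ 1 := ((lt_div_iff₀ ha3).1 hρa).le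
    have hnest : (ρ * a ^ 3) ^ (η' - η) ≤ 1 / 2 := by
      simpa only [one_mul] using H₂ _ ht0 ((lt_div_iff₀ ha3).1 hρ2)
    have hB : 2 * Real.sqrt C' * a ^ ε * (ρ * a ^ 3) ^ e ≤ (1 - (2 : ℝ) ^ (-ε)) / 8 :=
      H₃ _ ht0 ((lt_div_iff₀ ha3).1 hρ3)
    refine ⟨fun j => 2 * Real.sqrt C' * a ^ ε * (ρ * a ^ 3) ^ e * ((2 : ℝ) ^ (-ε)) ^ j,
      fun j => by positivity, (summable_geometric_of_lt_one hr0.le hr1).mul_left _, ?_, ?_⟩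
    · rw [tsum_mul_left, tsum_geometric_of_lt_one hr0.le hr1, ← div_eq_mul_inv,
        div_le_iff₀ (sub_pos.2 hr1)]
      linarith
    filter_upwards [HW ρ hρ hρ1] with N hN
    dsimp only at hN ⊢
    generalize sideLength ρ N = L at hN ⊢
    obtain ⟨δ, hδ, hΨW⟩ := hN
    refine ⟨δ, hδ, fun Ψ hΨ m j hm h1 _ hwin => ?_⟩
    obtain ⟨-, hTN, hA⟩ := hI N L Ψ m hm
    have hocc := hΨW Ψ hΨ (m - 1) (window_nesting hρ ha hm hnest hwin)
    exact defect_le (by positivity) hocc hTN hA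
      (sqrt_deficit_le hρ ha hη0 hC' hε.le hm hrel ht1 h1 hwin)

end Summit.AtomisticToContinuum.BoseEinsteinCondensation.Cruxes.DyadicCoherenceDefect.Birth

end
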